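import Summits.BirchSwinnertonDyer.BirchSwinnertonDyer.Theorems.PrintCf2SplitBadTwoRestrictedSelmerBottomShaBridge
import Summits.BirchSwinnertonDyer.BirchSwinnertonDyer.Theorems.PrintCf2SplitBadTwoCMShaDescentSquare
import Literature.NumberTheory.GaloisRepresentations.DiscreteCochains
import HarnessLib

/-!
# Crux `PrintCf2.SplitBadTwoRankOneOfFacts` (item stmt-BirchSwinnertonDyer-20368), road α, S3c₂ bottom value, factor (F2):
# the image in `Ш(E_K/K)` of the `𝔮`-summand's Selmer group LIES IN THE `r`-EIGEN SUBGROUP of `Ш(E_K/K)[p^∞]`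

Cell `bsd-print-cf2`, width seat `bsd-line-cf2-p1-w8` g2 (brick **B6f**, part 1: -w7 g2's 20:34:53Z «remaining = eigen identification with -w8's
`C` + B6e», factor (F2) of `rBV_of_three_factor_values`); `--supports stmt-BirchSwinnertonDyer-20368` (helper, Theses-free). HONEST FRAMING:
nothing here closes a crux or a stub; BSD is not proved by any of this; no summit statement is proved by this seat. No definition, no named
fact, no `sorry`. beyond-print theorem: no.

SETTING (generic): `V/K` elliptic over a number field, `p` prime, `π ∈ End_K(E)`, `r ∈ ℤ_p`, `M = E[𝔮^∞] := V.endEigenPrimaryTorsion p π r`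
(the points of `E[p^∞]` on which `π` acts as `r`, integer-approximation currency), `ι : M ↪ E[p^∞]`, and -w7 g2's map
`f = primaryH1ToH1 ∘ res_⊤⁻¹ ∘ ι_* : H¹(⊤, M) → H¹(K, E)` (file `…RestrictedSelmerBottomShaBridge`, `res_⊤⁻¹` by `AddEquiv.ofBijective`).

* §1 plumbing: `exists_le_forall_pow_smul_eq_zero_of_finite` (a finite set of `p`-power-torsion elements has a common exponent);
  `zsmul_eq_zsmul_of_approx'` (two integers `≡ r (mod p^k)` act alike on an element killed by `p^k`; the tree's private lemma of
  `EndomorphismEigenPrimaryTorsion`, re-proved).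
* §2 **`resH1Hom_endo_incl_eq_zsmul`** — on a class `c ∈ H¹(⊤, M)` the endomorphism `π` (pushed to `H¹(⊤, E[p^∞])`) acts as an INTEGER:
  for every `k` there is `N ≡ r (mod p^k)` with `π_* (ι_* c) = N • ι_* c`. Proof: a continuous cocycle on the compact `Γ_K` with values
  in the discrete `M` has finite range (`finite_range_of_compact_discrete`), so all its values die under one `p^j`, `j ≥ k`; on `M[p^j]`
  the endomorphism `π` IS the integer `N = appr_j(r)` (definition of `E[𝔮^∞]`), so `π ∘ a = N • a` as cocycles.
* §3 **`galH1Map_shaBridge_eq_zsmul`** — NATURALITY + EIGEN PROPERTY: for an isogeny `φ` acting as `π` on points,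
  `Ш(φ) (f c) = N • f c` whenever `p^k • f c = 0` and `N ≡ r (mod p^k)` (the maps `ι_*`, `res_⊤`, `primaryH1ToH1`, `galH1Map` are all
  `resH1Hom`s of compatible pairs and commute with `π` by `resH1Hom_comp`); `shaBridge_mem_primaryComponent` (`f c ∈ H¹(K, E)[p^∞]`,
  `range_primaryH1ToH1_le_primaryComponent`). HENCE **`exists_injective_range_shaBridge_to_eigen`**: every `f c` which lies in `Ш(E_K/K)`
  belongs, as an element of `Ш(E_K/K)[p^∞]`, to the `r`-eigen subgroup `C` of -w2 g7 / -w8's currency (`x ∈ C ↔ ∀ k N, p^k x = 0 → N ≡ r →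
  Ш(φ) x = N x`) — an INJECTIVE additive `f(S) → C` over `H¹(K, E)` — and
  **`natCard_range_shaBridge_le`**: `#f(S) ≤ #C` for every `S ≤ H¹(⊤, M)` with `f(S) ≤ Ш` and `C` finite — with -w8 g2's
  `natCard_cmPrimary_sha_eq_of_isogeny` (p665921): `#f(S) ≤ #Ш(W/ℚ)[2^∞]` on the crux's frames, i.e. ONE INEQUALITY of (F2); the
  reverse inclusion `C ≤ f(𝔖_v ⊓ L_M)` (decomposition of `Sel_{2^∞}` along `E[2^∞] = E[𝔮^∞] ⊕ E[𝔮̄^∞]` + strictness at `v`) is part 2.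

References: A. Agboola, Compositio 143 (2007) §6 Props. 6.10–6.11 [Agboola2007]; K. Rubin, LNM 1716 (1999) §2 [Rubin1999]; J.-P. Serre,
*Galois Cohomology* I.§2 [SerreGaloisCohomology1997]; R. Greenberg, LNM 1716 §2 p. 63 [GreenbergLNM1716].
-/

noncomputable section

open scoped Classical

set_option linter.dupNamespace false
set_option autoImplicit false

namespace Summit.BirchSwinnertonDyer.BirchSwinnertonDyer.Theorems.PrintCf2.CMPrimes

open WeierstrassCurve Literature.NumberTheory.EllipticCurves Literature.NumberTheory.GaloisRepresentations Field NumberField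
open Literature.NumberTheory.EllipticCurves.ResKernel
open Summit.BirchSwinnertonDyer.BirchSwinnertonDyer.Theorems.PrintCf2.RestrictedSelmerPair

universe u

/-! ## §1 Plumbing: common exponents, integer approximations -/

section Plumbing

/-- A finite set of elements each killed by a power of `p` has a COMMON killing power `p^j`, `j ≥ k`. [folklore] -/
theorem exists_le_forall_pow_smul_eq_zero_of_finite {A : Type*} [AddCommGroup A] (p : ℕ) {F : Set A} (hF : F.Finite)
    (h : ∀ m ∈ F, ∃ i : ℕ, p ^ i • m = 0) (k : ℕ) : ∃ j : ℕ, k ≤ j ∧ ∀ m ∈ F, p ^ j • m = 0 := by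
  induction F, hF using Set.Finite.induction_on with
  | empty => exact ⟨k, le_rfl, fun m hm ↦ (Set.notMem_empty m hm).elim⟩
  | @insert a s ha hs ih =>
    obtain ⟨j₀, hkj₀, hj₀⟩ := ih fun m hm ↦ h m (Set.mem_insert_of_mem _ hm)
    obtain ⟨i, hi⟩ := h a (Set.mem_insert _ _)
    refine ⟨j₀ + i, hkj₀.trans (Nat.le_add_right _ _), fun m hm ↦ ?_⟩
    rcases Set.mem_insert_iff.mp hm with rfl | hm
    · rw [pow_add, mul_smul, hi, smul_zero]
    · rw [pow_add, mul_comm, mul_smul, hj₀ m hm, smul_zero]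

/-- Two integers approximating the same `p`-adic integer to order `p^k` act alike on an element killed by `p^k` (the tree's private
`EndomorphismEigenPrimaryTorsion.zsmul_eq_zsmul_of_approx`, re-proved). [folklore] -/
theorem zsmul_eq_zsmul_of_approx' (p : ℕ) [Fact p.Prime] {A : Type*} [AddCommGroup A] {k : ℕ} {x : A} (hx : p ^ k • x = 0)
    {r : ℤ_[p]} {N N' : ℤ} (hN : ((N : ℤ_[p]) - r) ∈ (Ideal.span {(p : ℤ_[p]) ^ k} : Ideal ℤ_[p]))
    (hN' : ((N' : ℤ_[p]) - r) ∈ (Ideal.span {(p : ℤ_[p]) ^ k} : Ideal ℤ_[p])) : N • x = N' • x := by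
  have h : ((N - N' : ℤ) : ℤ_[p]) ∈ (Ideal.span {(p : ℤ_[p]) ^ k} : Ideal ℤ_[p]) := by
    have := Ideal.sub_mem _ hN hN'
    push_cast
    convert this using 1
    ring
  have hdvd : (p ^ k : ℤ) ∣ N - N' := by
    rw [← PadicInt.norm_int_le_pow_iff_dvd]
    exact (PadicInt.norm_le_pow_iff_mem_span_pow _ _).mpr h
  obtain ⟨c, hc⟩ := hdvd
  have hpk : ((p : ℤ) ^ k) • x = 0 := by
    rw [show ((p : ℤ) ^ k) = ((p ^ k : ℕ) : ℤ) by push_cast; rfl, natCast_zsmul, hx]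
  have h1 : (N - N') • x = 0 := by rw [hc, mul_comm, mul_zsmul, hpk, zsmul_zero]
  rw [sub_smul] at h1
  exact sub_eq_zero.mp h1

/-- An integer approximating `r ∈ ℤ_p` to order `p^j` (`PadicInt.appr`). [folklore] -/
theorem exists_int_sub_mem_span_pow (p : ℕ) [Fact p.Prime] (r : ℤ_[p]) (j : ℕ) :
    ∃ N : ℤ, ((N : ℤ_[p]) - r) ∈ (Ideal.span {(p : ℤ_[p]) ^ j} : Ideal ℤ_[p]) := by
  refine ⟨(PadicInt.appr r j : ℤ), ?_⟩
  have h := PadicInt.appr_spec j r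
  rw [← Ideal.neg_mem_iff, neg_sub] at h
  push_cast
  exact h

/-- Approximations descend in level: `N ≡ r (mod p^j)` and `k ≤ j` give `N ≡ r (mod p^k)`. [folklore] -/
theorem sub_mem_span_pow_of_le (p : ℕ) [Fact p.Prime] {r : ℤ_[p]} {N : ℤ} {j k : ℕ} (hkj : k ≤ j)
    (hN : ((N : ℤ_[p]) - r) ∈ (Ideal.span {(p : ℤ_[p]) ^ j} : Ideal ℤ_[p])) :
    ((N : ℤ_[p]) - r) ∈ (Ideal.span {(p : ℤ_[p]) ^ k} : Ideal ℤ_[p]) :=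
  Ideal.span_singleton_le_span_singleton.mpr (pow_dvd_pow _ hkj) hN

end Plumbing

/-! ## §2 `π` acts on a class of `H¹(⊤, E[𝔮^∞])` as an integer `≡ r` -/

section EigenClass

variable {K : Type u} [Field K] [NumberField K] (V : WeierstrassCurve K) (p : ℕ) [Fact p.Prime]
  (π : V.endRing) (r : ℤ_[p])

omit [NumberField K] [Fact p.Prime] in
/-- `π` preserves `E[p^∞]` (`p^k (π x) = π (p^k x) = 0`). [folklore] -/
theorem map_endRing_mem_geomPrimaryTorsion (x : V.geomPrimaryTorsion p) :
    (π : AddMonoid.End V.geomPoints) (x : V.geomPoints) ∈ V.geomPrimaryTorsion p := by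
  obtain ⟨n, hn⟩ := (AddCommGroup.mem_primaryComponent).mp x.2
  exact (AddCommGroup.mem_primaryComponent).mpr ⟨n, by
    rw [← map_nsmul ((π : AddMonoid.End V.geomPoints) : V.geomPoints →+ V.geomPoints), hn, map_zero]⟩

/-- **`π` acts on `H¹(⊤, E[𝔮^∞])`-classes through integers.** For `c ∈ H¹(⊤, M)`, `M = E[𝔮^∞]`, every `k`, and ANY additive
`πp : E[p^∞] → E[p^∞]` agreeing with `π` on points (hence `Γ_K`-equivariant): there is an integer `N ≡ r (mod p^k)` with
`πp_* (ι_* c) = N • ι_* c` in `H¹(⊤, E[p^∞])`. A continuous cocycle on the compact `Γ_K` into the discrete `M` takes finitely many values,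
all killed by one `p^j` (`j ≥ k`); on `M[p^j]`, `π` is the integer `N = appr_j(r)` by the definition of the eigen-subgroup, so
`πp ∘ (ι ∘ a) = N • (ι ∘ a)` as cocycles. [cite: Rubin1999, §2 and Prop. 5.4] [cite: SerreGaloisCohomology1997, I.§2.2] -/
theorem resH1Hom_endo_incl_eq_zsmul (πp : ↥(V.geomPrimaryTorsion p) →+ ↥(V.geomPrimaryTorsion p))
    (hπp : ∀ x : V.geomPrimaryTorsion p, ((πp x : V.geomPrimaryTorsion p) : V.geomPoints) =
      (π : AddMonoid.End V.geomPoints) (x : V.geomPoints))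
    (hπpG : ∀ (g : ↥(⊤ : Subgroup (absoluteGaloisGroup K))) (m : V.geomPrimaryTorsion p),
      πp (ContinuousMonoidHom.id _ g • m) = g • πp m)
    (c : subgroupH1 (⊤ : Subgroup (absoluteGaloisGroup K)) ↥(V.endEigenPrimaryTorsion p π r)) (k : ℕ) :
    ∃ N : ℤ, ((N : ℤ_[p]) - r) ∈ (Ideal.span {(p : ℤ_[p]) ^ k} : Ideal ℤ_[p]) ∧
      resH1Hom (ContinuousMonoidHom.id _) πp hπpG
          (resH1Hom (ContinuousMonoidHom.id _) (V.endEigenPrimaryTorsion p π r).subtype (fun _ _ ↦ rfl) c) =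
        N • resH1Hom (ContinuousMonoidHom.id _) (V.endEigenPrimaryTorsion p π r).subtype (fun _ _ ↦ rfl) c := by
  set M := V.endEigenPrimaryTorsion p π r with hM
  obtain ⟨a, rfl⟩ := oneCocycleClass_surjective (discreteTopRep (↥(⊤ : Subgroup (absoluteGaloisGroup K))) ↥M) c
  -- a common exponent for the finitely many values of `a`
  haveI : CompactSpace (↥(⊤ : Subgroup (absoluteGaloisGroup K))) :=
    isCompact_iff_compactSpace.mp (by rw [Subgroup.coe_top]; exact isCompact_univ)
  have hfin : (Set.range a.1).Finite := finite_range_of_compact_discrete a.1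
  obtain ⟨j, hkj, hj⟩ := exists_le_forall_pow_smul_eq_zero_of_finite p hfin (fun m _ ↦ by
    obtain ⟨n, hn⟩ := (AddCommGroup.mem_primaryComponent).mp (m : V.geomPrimaryTorsion p).2
    exact ⟨n, Subtype.ext (Subtype.ext (by
      rw [AddSubmonoidClass.coe_nsmul, AddSubmonoidClass.coe_nsmul, ZeroMemClass.coe_zero, ZeroMemClass.coe_zero]; exact hn))⟩) k
  obtain ⟨N, hN⟩ := exists_int_sub_mem_span_pow p r j
  refine ⟨N, sub_mem_span_pow_of_le p hkj hN, ?_⟩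
  -- `π` is `N` on every value of `a`
  have hval : ∀ g, πp (M.subtype (a.1 g)) = N • M.subtype (a.1 g) := fun g ↦ by
    have hmem := (V.mem_endEigenPrimaryTorsion_iff π r (a.1 g : V.geomPrimaryTorsion p)).mp (a.1 g).2 j N
      (by have := congrArg Subtype.val (hj (a.1 g) ⟨g, rfl⟩); simpa using this) hN
    apply Subtype.ext
    rw [hπp, AddSubgroup.coe_subtype, AddSubgroupClass.coe_zsmul]
    exact hmem
  rw [resH1Hom_id_oneCocycleClass, resH1Hom_id_oneCocycleClass]
  have key : ∀ (A B : contOneCocycles (discreteTopRep (↥(⊤ : Subgroup (absoluteGaloisGroup K))) ↥(V.geomPrimaryTorsion p))),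
      A = N • B → oneCocycleClass _ A = N • oneCocycleClass _ B := by
    rintro A B rfl
    exact (oneCocycleClass_smul _ N _).trans (Int.cast_smul_eq_zsmul ℤ N _)
  refine key _ _ (Subtype.ext (ContinuousMap.ext fun g ↦ ?_))
  rw [contOneCocycles.push_apply, contOneCocycles.push_apply, Submodule.coe_smul, ContinuousMap.smul_apply,
    contOneCocycles.push_apply]
  exact hval g

end EigenClass

/-! ## §3 Naturality of -w7's bridge `f = primaryH1ToH1 ∘ res_⊤⁻¹ ∘ ι_*` and the eigen property of its image -/

section Bridge

variable {K : Type u} [Field K] [NumberField K] (V : WeierstrassCurve K) (p : ℕ) [Fact p.Prime]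
  (π : V.endRing) (r : ℤ_[p])

omit [NumberField K] [Fact p.Prime] in
/-- **Naturality of the bridge**: for `πp` = `π` on `E[p^∞]` and `φ` an isogeny acting as `π` on points,
`primaryH1ToH1 (res_⊤⁻¹ (πp_* y)) = Ш(φ) (primaryH1ToH1 (res_⊤⁻¹ y))` for every `y ∈ H¹(⊤, E[p^∞])` — all maps are `resH1Hom`s of compatible
pairs (`resH1Hom_comp`). [cite: SerreGaloisCohomology1997, I.§2.4] -/
theorem primaryH1ToH1_resTopSymm_resH1Hom_endo (πp : ↥(V.geomPrimaryTorsion p) →+ ↥(V.geomPrimaryTorsion p))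
    (hπp : ∀ x : V.geomPrimaryTorsion p, ((πp x : V.geomPrimaryTorsion p) : V.geomPoints) =
      (π : AddMonoid.End V.geomPoints) (x : V.geomPoints))
    (hπpG : ∀ (g : ↥(⊤ : Subgroup (absoluteGaloisGroup K))) (m : V.geomPrimaryTorsion p),
      πp (ContinuousMonoidHom.id _ g • m) = g • πp m)
    (φ : Isogeny V V) (hφ : ∀ P, φ P = (π : AddMonoid.End V.geomPoints) P)
    (y : subgroupH1 (⊤ : Subgroup (absoluteGaloisGroup K)) ↥(V.geomPrimaryTorsion p)) :
    V.primaryH1ToH1 p ((AddEquiv.ofBijective (resSubgroup (⊤ : Subgroup (absoluteGaloisGroup K)) ↥(V.geomPrimaryTorsion p))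
        (resSubgroup_top_bijective ↥(V.geomPrimaryTorsion p))).symm (resH1Hom (ContinuousMonoidHom.id _) πp hπpG y)) =
      galH1Map φ.toAddMonoidHom φ.equivariant (V.primaryH1ToH1 p ((AddEquiv.ofBijective (resSubgroup (⊤ : Subgroup (absoluteGaloisGroup K)) ↥(V.geomPrimaryTorsion p))
        (resSubgroup_top_bijective ↥(V.geomPrimaryTorsion p))).symm y)) := by
  set Re := AddEquiv.ofBijective (resSubgroup (⊤ : Subgroup (absoluteGaloisGroup K)) ↥(V.geomPrimaryTorsion p)) (resSubgroup_top_bijective ↥(V.geomPrimaryTorsion p))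
    with hRe
  have hπG : ∀ (g : absoluteGaloisGroup K) (m : V.geomPrimaryTorsion p),
      πp (ContinuousMonoidHom.id (absoluteGaloisGroup K) g • m) = g • πp m :=
    fun g m ↦ hπpG ⟨g, Subgroup.mem_top g⟩ m
  set x := Re.symm y with hx
  have hy : y = resSubgroup (⊤ : Subgroup (absoluteGaloisGroup K)) ↥(V.geomPrimaryTorsion p) x := (Re.apply_symm_apply y).symm
  -- `res_⊤` commutes with `πp_*`
  have key1 : (resH1Hom (ContinuousMonoidHom.id _) πp hπpG).comp
        (resSubgroup (⊤ : Subgroup (absoluteGaloisGroup K)) ↥(V.geomPrimaryTorsion p)) =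
      (resSubgroup (⊤ : Subgroup (absoluteGaloisGroup K)) ↥(V.geomPrimaryTorsion p)).comp
        (resH1Hom (ContinuousMonoidHom.id _) πp hπG) := by
    rw [resSubgroup, resH1Hom_comp, resH1Hom_comp]
    exact resH1Hom_congr (ContinuousMonoidHom.ext fun _ ↦ rfl) (AddMonoidHom.ext fun _ ↦ rfl) _ _
  have h1 : resH1Hom (ContinuousMonoidHom.id _) πp hπpG (resSubgroup (⊤ : Subgroup (absoluteGaloisGroup K)) ↥(V.geomPrimaryTorsion p) x) =
      resSubgroup (⊤ : Subgroup (absoluteGaloisGroup K)) ↥(V.geomPrimaryTorsion p) (resH1Hom (ContinuousMonoidHom.id _) πp hπG x) :=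
    congrArg (fun F : galH1Primary V p →+ subgroupH1 (⊤ : Subgroup (absoluteGaloisGroup K)) ↥(V.geomPrimaryTorsion p) ↦ F x) key1
  rw [hy, h1]
  change V.primaryH1ToH1 p (Re.symm (Re _)) = _
  rw [AddEquiv.symm_apply_apply]
  -- `primaryH1ToH1 ∘ πp_* = Ш(φ) ∘ primaryH1ToH1`
  have key2 : (V.primaryH1ToH1 p).comp (resH1Hom (ContinuousMonoidHom.id _) πp hπG) =
      (galH1Map φ.toAddMonoidHom φ.equivariant).comp (V.primaryH1ToH1 p) := by
    rw [WeierstrassCurve.primaryH1ToH1, galH1Map, resH1Hom_comp, resH1Hom_comp]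
    refine resH1Hom_congr rfl (AddMonoidHom.ext fun m ↦ ?_) _ _
    change ((πp m : V.geomPrimaryTorsion p) : V.geomPoints) = φ ((m : V.geomPrimaryTorsion p) : V.geomPoints)
    rw [hπp, hφ]
  exact congrArg (fun F : galH1Primary V p →+ V.galH1 ↦ F x) key2

omit [NumberField K] [Fact p.Prime] in
/-- `π` restricted to `E[p^∞]` as an additive map (codomain restriction of `π ∘ incl`), with its two bookkeeping identities.
[folklore] -/
theorem exists_endo_geomPrimaryTorsion :
    ∃ πp : ↥(V.geomPrimaryTorsion p) →+ ↥(V.geomPrimaryTorsion p),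
      (∀ x : V.geomPrimaryTorsion p, ((πp x : V.geomPrimaryTorsion p) : V.geomPoints) = (π : AddMonoid.End V.geomPoints) (x : V.geomPoints)) ∧
      ∀ (g : ↥(⊤ : Subgroup (absoluteGaloisGroup K))) (m : V.geomPrimaryTorsion p), πp (ContinuousMonoidHom.id _ g • m) = g • πp m := by
  have hequiv := (V.mem_equivariantSubring_iff (π : AddMonoid.End V.geomPoints)).1 (Subring.mem_inf.1 π.2).2
  refine ⟨(((π : AddMonoid.End V.geomPoints) : V.geomPoints →+ V.geomPoints).comp (V.geomPrimaryTorsion p).subtype).codRestrict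
    (V.geomPrimaryTorsion p) (fun x ↦ map_endRing_mem_geomPrimaryTorsion V p π x), fun _ ↦ rfl, fun g m ↦ Subtype.ext ?_⟩
  change (π : AddMonoid.End V.geomPoints) (((ContinuousMonoidHom.id _ g • m : V.geomPrimaryTorsion p)) : V.geomPoints) =
    (((g : absoluteGaloisGroup K) • _ : V.geomPrimaryTorsion p) : V.geomPoints)
  rw [primaryComponent.coe_smul]
  change (π : AddMonoid.End V.geomPoints) ((g : absoluteGaloisGroup K) • (m : V.geomPoints)) = _
  rw [hequiv]
  rfl

/-- **EIGEN PROPERTY OF THE BRIDGE.** For an isogeny `φ` acting as `π` on points and `c ∈ H¹(⊤, E[𝔮^∞])`: if `p^k • f c = 0` and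
`N ≡ r (mod p^k)` then `Ш(φ)(f c) = N • f c`, where `f = primaryH1ToH1 ∘ res_⊤⁻¹ ∘ ι_*` is the bridge of
`…RestrictedSelmerBottomShaBridge`. [cite: Rubin1999, §2 and Prop. 5.4] [cite: SerreGaloisCohomology1997, I.§2.4] -/
theorem galH1Map_shaBridge_eq_zsmul (φ : Isogeny V V) (hφ : ∀ P, φ P = (π : AddMonoid.End V.geomPoints) P)
    (c : subgroupH1 (⊤ : Subgroup (absoluteGaloisGroup K)) ↥(V.endEigenPrimaryTorsion p π r)) {k : ℕ} {N : ℤ}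
    (hk : p ^ k • V.primaryH1ToH1 p ((AddEquiv.ofBijective (resSubgroup (⊤ : Subgroup (absoluteGaloisGroup K)) ↥(V.geomPrimaryTorsion p))
        (resSubgroup_top_bijective ↥(V.geomPrimaryTorsion p))).symm
          (resH1Hom (ContinuousMonoidHom.id _) (V.endEigenPrimaryTorsion p π r).subtype (fun _ _ ↦ rfl) c)) = 0)
    (hN : ((N : ℤ_[p]) - r) ∈ (Ideal.span {(p : ℤ_[p]) ^ k} : Ideal ℤ_[p])) :
    galH1Map φ.toAddMonoidHom φ.equivariant (V.primaryH1ToH1 p ((AddEquiv.ofBijective (resSubgroup (⊤ : Subgroup (absoluteGaloisGroup K)) ↥(V.geomPrimaryTorsion p))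
        (resSubgroup_top_bijective ↥(V.geomPrimaryTorsion p))).symm
          (resH1Hom (ContinuousMonoidHom.id _) (V.endEigenPrimaryTorsion p π r).subtype (fun _ _ ↦ rfl) c))) =
      N • V.primaryH1ToH1 p ((AddEquiv.ofBijective (resSubgroup (⊤ : Subgroup (absoluteGaloisGroup K)) ↥(V.geomPrimaryTorsion p))
        (resSubgroup_top_bijective ↥(V.geomPrimaryTorsion p))).symm
          (resH1Hom (ContinuousMonoidHom.id _) (V.endEigenPrimaryTorsion p π r).subtype (fun _ _ ↦ rfl) c)) := by
  obtain ⟨πp, hπp, hπpG⟩ := exists_endo_geomPrimaryTorsion V p π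
  obtain ⟨N', hN', hc⟩ := resH1Hom_endo_incl_eq_zsmul V p π r πp hπp hπpG c k
  rw [← primaryH1ToH1_resTopSymm_resH1Hom_endo V p π πp hπp hπpG φ hφ, hc, map_zsmul, map_zsmul]
  exact zsmul_eq_zsmul_of_approx' p hk hN' hN

omit [Fact p.Prime] in
/-- The bridge lands in `H¹(K, E)[p^∞]` (`range_primaryH1ToH1_le_primaryComponent`). [cite: GreenbergLNM1716, §2 p. 63] -/
theorem shaBridge_mem_primaryComponent (x : galH1Primary V p) :
    V.primaryH1ToH1 p x ∈ AddCommGroup.primaryComponent V.galH1 p :=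
  range_primaryH1ToH1_le_primaryComponent V p ⟨x, rfl⟩

variable (S : AddSubgroup (subgroupH1 (⊤ : Subgroup (absoluteGaloisGroup K)) ↥(V.endEigenPrimaryTorsion p π r)))

/-- **THE IMAGE OF THE `𝔮`-SUMMAND LIES IN THE `r`-EIGEN SUBGROUP OF `Ш[p^∞]`.** Let `S ≤ H¹(⊤, E[𝔮^∞])` with `f(S) ≤ Ш(E_K/K)`
(e.g. `S = 𝔖_v(K, E[𝔮^∞]) ⊓ L_M`, -w7 g2's `natCard_trueSelmer_quotient_eq_natCard_range_shaMap`), `φ` an isogeny acting as `π`, and `C` THE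
`r`-eigen subgroup of `Ш(E_K/K)[p^∞]` (-w2 g7 / -w8 currency). Then every element of `f(S)`, read in `Ш(E_K/K)[p^∞]`, lies in `C`:
there is an INJECTIVE additive map `f(S) → C` compatible with the inclusions into `H¹(K, E)`.
[cite: Agboola2007, Props. 6.10–6.11 (arXiv p0014:L1–p0015:L12)] [cite: Rubin1999, §2 and Prop. 5.4] -/
theorem exists_injective_range_shaBridge_to_eigen (φ : Isogeny V V) (hφ : ∀ P, φ P = (π : AddMonoid.End V.geomPoints) P)
    (hS : (((V.primaryH1ToH1 p).comp (AddEquiv.ofBijective (resSubgroup (⊤ : Subgroup (absoluteGaloisGroup K)) ↥(V.geomPrimaryTorsion p))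
        (resSubgroup_top_bijective ↥(V.geomPrimaryTorsion p))).symm.toAddMonoidHom).comp
      ((resH1Hom (ContinuousMonoidHom.id _) (V.endEigenPrimaryTorsion p π r).subtype (fun _ _ ↦ rfl)).comp S.subtype)).range ≤
      V.sha)
    {C : AddSubgroup (AddCommGroup.primaryComponent V.sha p)}
    (hC : ∀ x, x ∈ C ↔ ∀ (k : ℕ) (N : ℤ), p ^ k • x = 0 →
      ((N : ℤ_[p]) - r) ∈ (Ideal.span {(p : ℤ_[p]) ^ k} : Ideal ℤ_[p]) →
        galH1Map φ.toAddMonoidHom φ.equivariant (((x : AddCommGroup.primaryComponent V.sha p) : V.sha) : V.galH1) =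
          N • (((x : AddCommGroup.primaryComponent V.sha p) : V.sha) : V.galH1)) :
    ∃ e : ↥(((V.primaryH1ToH1 p).comp (AddEquiv.ofBijective (resSubgroup (⊤ : Subgroup (absoluteGaloisGroup K)) ↥(V.geomPrimaryTorsion p))
        (resSubgroup_top_bijective ↥(V.geomPrimaryTorsion p))).symm.toAddMonoidHom).comp
      ((resH1Hom (ContinuousMonoidHom.id _) (V.endEigenPrimaryTorsion p π r).subtype (fun _ _ ↦ rfl)).comp S.subtype)).range →+ ↥C,
      Function.Injective e ∧ ∀ x, (((e x : AddCommGroup.primaryComponent V.sha p) : V.sha) : V.galH1) = (x : V.galH1) := by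
  set f := ((V.primaryH1ToH1 p).comp (AddEquiv.ofBijective (resSubgroup (⊤ : Subgroup (absoluteGaloisGroup K)) ↥(V.geomPrimaryTorsion p))
        (resSubgroup_top_bijective ↥(V.geomPrimaryTorsion p))).symm.toAddMonoidHom).comp
      ((resH1Hom (ContinuousMonoidHom.id _) (V.endEigenPrimaryTorsion p π r).subtype (fun _ _ ↦ rfl)).comp S.subtype) with hf
  -- every element of `range f` is in `Ш`, is `p`-primary in `Ш`, and satisfies the eigen condition
  have hsha : ∀ x : f.range, (x : V.galH1) ∈ V.sha := fun x ↦ hS x.2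
  have hprim : ∀ x : f.range, (⟨(x : V.galH1), hsha x⟩ : V.sha) ∈ AddCommGroup.primaryComponent V.sha p := fun x ↦ by
    obtain ⟨c, hc⟩ := x.2
    obtain ⟨n, hn⟩ := (AddCommGroup.mem_primaryComponent).mp (shaBridge_mem_primaryComponent V p
      ((AddEquiv.ofBijective (resSubgroup (⊤ : Subgroup (absoluteGaloisGroup K)) ↥(V.geomPrimaryTorsion p)) (resSubgroup_top_bijective ↥(V.geomPrimaryTorsion p))).symm
        (resH1Hom (ContinuousMonoidHom.id _) (V.endEigenPrimaryTorsion p π r).subtype (fun _ _ ↦ rfl) (c : subgroupH1 ⊤ _))))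
    refine (AddCommGroup.mem_primaryComponent).mpr ⟨n, Subtype.ext ?_⟩
    rw [AddSubmonoidClass.coe_nsmul, ZeroMemClass.coe_zero]
    change p ^ n • (x : V.galH1) = 0
    rw [← hc]
    exact hn
  have heig : ∀ x : f.range, (⟨⟨(x : V.galH1), hsha x⟩, hprim x⟩ : AddCommGroup.primaryComponent V.sha p) ∈ C := fun x ↦ by
    rw [hC]
    intro k N hk hN
    obtain ⟨c, hc⟩ := x.2
    change galH1Map φ.toAddMonoidHom φ.equivariant (x : V.galH1) = N • (x : V.galH1)
    have hk' : p ^ k • (x : V.galH1) = 0 := by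
      have h := congrArg (fun z : AddCommGroup.primaryComponent V.sha p ↦ ((z : V.sha) : V.galH1)) hk
      simpa using h
    rw [← hc] at hk' ⊢
    exact galH1Map_shaBridge_eq_zsmul V p π r φ hφ (c : subgroupH1 ⊤ _) hk' hN
  refine ⟨{ toFun := fun x ↦ ⟨⟨⟨(x : V.galH1), hsha x⟩, hprim x⟩, heig x⟩,
             map_zero' := Subtype.ext (Subtype.ext (Subtype.ext rfl)),
             map_add' := fun x y ↦ Subtype.ext (Subtype.ext (Subtype.ext rfl)) }, fun x y h ↦ ?_, fun x ↦ rfl⟩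
  exact Subtype.ext (show (x : V.galH1) = (y : V.galH1) from
    congrArg (fun z : ↥C ↦ (((z : AddCommGroup.primaryComponent V.sha p) : V.sha) : V.galH1)) h)

/-- **`#f(S) ≤ #C`** for the `r`-eigen subgroup `C` of `Ш(E_K/K)[p^∞]` when `C` is finite. [cite: Agboola2007, Props. 6.10–6.11 (arXiv p0014:L1–p0015:L12)] -/
theorem natCard_range_shaBridge_le (φ : Isogeny V V) (hφ : ∀ P, φ P = (π : AddMonoid.End V.geomPoints) P)
    (hS : (((V.primaryH1ToH1 p).comp (AddEquiv.ofBijective (resSubgroup (⊤ : Subgroup (absoluteGaloisGroup K)) ↥(V.geomPrimaryTorsion p))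
        (resSubgroup_top_bijective ↥(V.geomPrimaryTorsion p))).symm.toAddMonoidHom).comp
      ((resH1Hom (ContinuousMonoidHom.id _) (V.endEigenPrimaryTorsion p π r).subtype (fun _ _ ↦ rfl)).comp S.subtype)).range ≤
      V.sha)
    {C : AddSubgroup (AddCommGroup.primaryComponent V.sha p)}
    (hC : ∀ x, x ∈ C ↔ ∀ (k : ℕ) (N : ℤ), p ^ k • x = 0 →
      ((N : ℤ_[p]) - r) ∈ (Ideal.span {(p : ℤ_[p]) ^ k} : Ideal ℤ_[p]) →
        galH1Map φ.toAddMonoidHom φ.equivariant (((x : AddCommGroup.primaryComponent V.sha p) : V.sha) : V.galH1) =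
          N • (((x : AddCommGroup.primaryComponent V.sha p) : V.sha) : V.galH1))
    (hCfin : (C : Set (AddCommGroup.primaryComponent V.sha p)).Finite) :
    Nat.card ↥(((V.primaryH1ToH1 p).comp (AddEquiv.ofBijective (resSubgroup (⊤ : Subgroup (absoluteGaloisGroup K)) ↥(V.geomPrimaryTorsion p))
        (resSubgroup_top_bijective ↥(V.geomPrimaryTorsion p))).symm.toAddMonoidHom).comp
      ((resH1Hom (ContinuousMonoidHom.id _) (V.endEigenPrimaryTorsion p π r).subtype (fun _ _ ↦ rfl)).comp S.subtype)).range ≤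
      Nat.card ↥C := by
  obtain ⟨e, he, -⟩ := exists_injective_range_shaBridge_to_eigen V p π r S φ hφ hS hC
  haveI : Finite ↥C := hCfin.to_subtype
  exact Nat.card_le_card_of_injective e he

end Bridge

end Summit.BirchSwinnertonDyer.BirchSwinnertonDyer.Theorems.PrintCf2.CMPrimes

end
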